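import Summits.CriticalPhenomena.PercolationContinuityZ3.Theorems.Transplant.FKConnectivityAllQAntipodalOrAttSides
import HarnessLib

/-!
# Connectivity correlation inequalities for `φ_{w,q}`, every `q > 0` — file 63a: INPUTS of the AND-attached OR drift induction — the master
# weighted AND theorem with a general attached set, in the shapes produced by the junction identities

Support file (`--supports stmt-CriticalPhenomena-4575`), FK sub-lane `prim-bschramm-fk-2` (gen 29; the `A ⊇ C` analogue of gen 22's file 47e₀
`…OrAttInputs`); builds on p205010 (kernel theorem, internal audit signed; external expert review pending).  No definitions, no named facts, no
sorries; standard axioms.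

`O_A(N; y, z; C) = D(yzA | C) + D(zA | yC) + D(yA | zC)`, `C ⊆ A` (memo FROM-fk-2-g29-BRIDGE §11): the antipodal form of
`ω_{st} · ∏_{e ∈ A \ C} ω_e · (ω_y ∨ ω_z)` — the level-4 type T1 for `|A \ C| = 1`.  For a sub-network `F` of the host and the cell
`(N ∩ F, A ∩ F, C ∩ F)` this file packages the instances of the master weighted AND theorem with a GENERAL attached set
(`FK.andGenW_virt_nonpos_of_isTTSP`, `FK.andGenW_rootless_nonpos_of_isTTSP` of `…OrAttSides`) that the junction lemmas `…OrAttTSeries`,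
`…OrAttTSeriesSame`, `…OrAttTParallel` consume: the `(A|C)` drift of `(N ∩ F) ∪ {e}` with root, without root and with the root contracted
(`FK.orAttT_inU/inV/inL`), the drift `(eA|C)` of `N ∩ F` in the same three forms (`FK.orAttT_inA/inR/inK`), and the `(A|C)` drift of `N ∩ F`
(`FK.orAttT_inP/inPV/inL₀`).  (Where gen 22 had U-drifts `(C|C)` whose rootless companions vanish, the companions are now signed drifts.)
[cite: Grimmett2006, §1.4 eq. (1.20) (p. 15); §3.8 Thm. (3.90) (pp. 61–62); §3.9 (pp. 63–64)] [cite: Wagner2006, Thm. 5.8(d), §5.3]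
-/

noncomputable section

namespace Summit.CriticalPhenomena.PercolationContinuityZ3.Theorems

namespace FK

open SimpleGraph Literature.Probability.LatticeModels Literature.Probability.Percolation
open scoped Classical

variable {V : Type*} [Fintype V]

section OrAttTInputs

variable {N A C F : Finset (Sym2 V)}

omit [Fintype V] in
/-- The side cell inherits `C ∩ F ⊆ A ∩ F` and `(N ∩ F) ∩ (A ∩ F) = ∅`. [folklore] -/
theorem orAttT_side (hCA : C ⊆ A) (hNA : Disjoint N A) : C ∩ F ⊆ A ∩ F ∧ Disjoint (N ∩ F) (A ∩ F) :=
  ⟨Finset.inter_subset_inter hCA subset_rfl,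
    Finset.disjoint_of_subset_left Finset.inter_subset_left (Finset.disjoint_of_subset_right Finset.inter_subset_left hNA)⟩

/-- Oracle: the `(A ∩ F | C ∩ F)` drift of the free set `(N ∩ F) ∪ {e}`, root `ab` (possibly an edge of `F`).
[cite: Grimmett2006, §3.8 Thm. (3.90) (pp. 61–62)] -/
theorem orAttT_inU {a b : V} {e : Sym2 V} (hF : IsTTSP F a b) (he : e ∈ F) (heA : e ∉ A) (hCA : C ⊆ A) (hNA : Disjoint N A) :
    ∀ w' : ℕ → ℝ, (∀ k : ℕ, w' (k + 1) ≤ w' k) → ∀ h' : Finset (Sym2 V) → ℝ,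
      (∀ ⦃X Y : Finset (Sym2 V)⦄, X ⊆ Y → Y ⊆ insert e (N ∩ F) → h' X ≤ h' Y) →
      ∑ γ ∈ (insert e (N ∩ F)).powerset, (w' (clusterCount (↑(insert s(a, b) (γ ∪ A ∩ F)) : BondConfig V) ∅ +
          clusterCount (↑(insert e (N ∩ F) \ γ ∪ C ∩ F) : BondConfig V) ∅) -
        w' (clusterCount (↑(insert s(a, b) (insert e (N ∩ F) \ γ ∪ A ∩ F)) : BondConfig V) ∅ +
          clusterCount (↑(γ ∪ C ∩ F) : BondConfig V) ∅)) * h' γ ≤ 0 :=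
  fun _ hw' _ hm' => andGenW_virt_nonpos_of_isTTSP hF (Finset.insert_subset he Finset.inter_subset_right) Finset.inter_subset_right
    (orAttT_side hCA hNA).1 (Finset.disjoint_insert_left.2 ⟨fun hh => heA (Finset.mem_of_mem_inter_left hh), (orAttT_side hCA hNA).2⟩)
    hw' hm'

/-- Oracle: the ROOTLESS `(A ∩ F | C ∩ F)` drift of the free set `(N ∩ F) ∪ {e}`. [cite: Grimmett2006, §3.8 Thm. (3.90) (pp. 61–62)] -/
theorem orAttT_inV {a b : V} {e : Sym2 V} (hF : IsTTSP F a b) (he : e ∈ F) (heA : e ∉ A) (hCA : C ⊆ A) (hNA : Disjoint N A) :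
    ∀ w' : ℕ → ℝ, (∀ k : ℕ, w' (k + 1) ≤ w' k) → ∀ h' : Finset (Sym2 V) → ℝ,
      (∀ ⦃X Y : Finset (Sym2 V)⦄, X ⊆ Y → Y ⊆ insert e (N ∩ F) → h' X ≤ h' Y) →
      ∑ γ ∈ (insert e (N ∩ F)).powerset, (w' (clusterCount (↑(γ ∪ A ∩ F) : BondConfig V) ∅ +
          clusterCount (↑(insert e (N ∩ F) \ γ ∪ C ∩ F) : BondConfig V) ∅) -
        w' (clusterCount (↑(insert e (N ∩ F) \ γ ∪ A ∩ F) : BondConfig V) ∅ + clusterCount (↑(γ ∪ C ∩ F) : BondConfig V) ∅)) * h' γ ≤ 0 :=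
  fun _ hw' _ hm' => andGenW_rootless_nonpos_of_isTTSP hF (Finset.insert_subset he Finset.inter_subset_right)
    (Finset.inter_subset_right.trans (Finset.subset_insert _ _)) (orAttT_side hCA hNA).1
    (Finset.disjoint_insert_left.2 ⟨fun hh => heA (Finset.mem_of_mem_inter_left hh), (orAttT_side hCA hNA).2⟩) hw' hm'

/-- Oracle: the drift `(e, A ∩ F | C ∩ F)` of the free set `N ∩ F`, root `ab` (possibly an edge of `F`).
[cite: Grimmett2006, §3.8 Thm. (3.90) (pp. 61–62)] -/
theorem orAttT_inA {a b : V} {e : Sym2 V} (hF : IsTTSP F a b) (he : e ∈ F) (heN : e ∉ N) (hCA : C ⊆ A) (hNA : Disjoint N A) :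
    ∀ w' : ℕ → ℝ, (∀ k : ℕ, w' (k + 1) ≤ w' k) → ∀ h' : Finset (Sym2 V) → ℝ,
      (∀ ⦃X Y : Finset (Sym2 V)⦄, X ⊆ Y → Y ⊆ N ∩ F → h' X ≤ h' Y) →
      ∑ γ ∈ (N ∩ F).powerset, (w' (clusterCount (↑(insert s(a, b) (γ ∪ insert e (A ∩ F))) : BondConfig V) ∅ +
          clusterCount (↑((N ∩ F) \ γ ∪ C ∩ F) : BondConfig V) ∅) -
        w' (clusterCount (↑(insert s(a, b) ((N ∩ F) \ γ ∪ insert e (A ∩ F))) : BondConfig V) ∅ +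
          clusterCount (↑(γ ∪ C ∩ F) : BondConfig V) ∅)) * h' γ ≤ 0 :=
  fun _ hw' _ hm' => andGenW_virt_nonpos_of_isTTSP hF Finset.inter_subset_right (Finset.insert_subset he Finset.inter_subset_right)
    ((orAttT_side hCA hNA).1.trans (Finset.subset_insert _ _))
    (Finset.disjoint_insert_right.2 ⟨fun hh => heN (Finset.mem_of_mem_inter_left hh), (orAttT_side hCA hNA).2⟩) hw' hm'

/-- Oracle: the rootless drift `(e, A ∩ F | C ∩ F)` of the free set `N ∩ F`. [cite: Grimmett2006, §3.8 Thm. (3.90) (pp. 61–62)] -/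
theorem orAttT_inR {a b : V} {e : Sym2 V} (hF : IsTTSP F a b) (he : e ∈ F) (heN : e ∉ N) (hCA : C ⊆ A) (hNA : Disjoint N A) :
    ∀ w' : ℕ → ℝ, (∀ k : ℕ, w' (k + 1) ≤ w' k) → ∀ h' : Finset (Sym2 V) → ℝ,
      (∀ ⦃X Y : Finset (Sym2 V)⦄, X ⊆ Y → Y ⊆ N ∩ F → h' X ≤ h' Y) →
      ∑ γ ∈ (N ∩ F).powerset, (w' (clusterCount (↑(γ ∪ insert e (A ∩ F)) : BondConfig V) ∅ +
          clusterCount (↑((N ∩ F) \ γ ∪ C ∩ F) : BondConfig V) ∅) -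
        w' (clusterCount (↑((N ∩ F) \ γ ∪ insert e (A ∩ F)) : BondConfig V) ∅ + clusterCount (↑(γ ∪ C ∩ F) : BondConfig V) ∅)) *
          h' γ ≤ 0 :=
  fun _ hw' _ hm' => andGenW_rootless_nonpos_of_isTTSP hF Finset.inter_subset_right
    ((Finset.insert_subset he Finset.inter_subset_right).trans (Finset.subset_insert _ _))
    ((orAttT_side hCA hNA).1.trans (Finset.subset_insert _ _))
    (Finset.disjoint_insert_right.2 ⟨fun hh => heN (Finset.mem_of_mem_inter_left hh), (orAttT_side hCA hNA).2⟩) hw' hm'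

/-- Oracle: the `(A ∩ F | C ∩ F)` drift of the free set `N ∩ F`, root `ab` (possibly an edge of `F`).
[cite: Grimmett2006, §3.8 Thm. (3.90) (pp. 61–62)] -/
theorem orAttT_inP {a b : V} (hF : IsTTSP F a b) (hCA : C ⊆ A) (hNA : Disjoint N A) :
    ∀ w' : ℕ → ℝ, (∀ k : ℕ, w' (k + 1) ≤ w' k) → ∀ h' : Finset (Sym2 V) → ℝ,
      (∀ ⦃X Y : Finset (Sym2 V)⦄, X ⊆ Y → Y ⊆ N ∩ F → h' X ≤ h' Y) →
      ∑ γ ∈ (N ∩ F).powerset, (w' (clusterCount (↑(insert s(a, b) (γ ∪ A ∩ F)) : BondConfig V) ∅ +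
          clusterCount (↑((N ∩ F) \ γ ∪ C ∩ F) : BondConfig V) ∅) -
        w' (clusterCount (↑(insert s(a, b) ((N ∩ F) \ γ ∪ A ∩ F)) : BondConfig V) ∅ + clusterCount (↑(γ ∪ C ∩ F) : BondConfig V) ∅)) *
          h' γ ≤ 0 :=
  fun _ hw' _ hm' => andGenW_virt_nonpos_of_isTTSP hF Finset.inter_subset_right Finset.inter_subset_right (orAttT_side hCA hNA).1
    (orAttT_side hCA hNA).2 hw' hm'

/-- Oracle: the ROOTLESS `(A ∩ F | C ∩ F)` drift of the free set `N ∩ F`. [cite: Grimmett2006, §3.8 Thm. (3.90) (pp. 61–62)] -/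
theorem orAttT_inPV {a b : V} (hF : IsTTSP F a b) (hCA : C ⊆ A) (hNA : Disjoint N A) :
    ∀ w' : ℕ → ℝ, (∀ k : ℕ, w' (k + 1) ≤ w' k) → ∀ h' : Finset (Sym2 V) → ℝ,
      (∀ ⦃X Y : Finset (Sym2 V)⦄, X ⊆ Y → Y ⊆ N ∩ F → h' X ≤ h' Y) →
      ∑ γ ∈ (N ∩ F).powerset, (w' (clusterCount (↑(γ ∪ A ∩ F) : BondConfig V) ∅ + clusterCount (↑((N ∩ F) \ γ ∪ C ∩ F) : BondConfig V) ∅) -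
        w' (clusterCount (↑((N ∩ F) \ γ ∪ A ∩ F) : BondConfig V) ∅ + clusterCount (↑(γ ∪ C ∩ F) : BondConfig V) ∅)) * h' γ ≤ 0 :=
  fun _ hw' _ hm' => andGenW_rootless_nonpos_of_isTTSP hF Finset.inter_subset_right
    (Finset.inter_subset_right.trans (Finset.subset_insert _ _)) (orAttT_side hCA hNA).1 (orAttT_side hCA hNA).2 hw' hm'

/-- Oracle (parallel strands): the `st`-CONTRACTED drift `(st, e, A ∩ F | st, C ∩ F)` of the free set `N ∩ F`, in the shape produced by
`FK.andGenW_parallel_eq`. [cite: Grimmett2006, §3.8 Thm. (3.90) (pp. 61–62)] -/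
theorem orAttT_inK {s t : V} {e : Sym2 V} (hst : s(s, t) ∉ F) (hF : IsTTSP F s t) (he : e ∈ F) (heN : e ∉ N) (hCA : C ⊆ A)
    (hNA : Disjoint N A) :
    ∀ w' : ℕ → ℝ, (∀ k : ℕ, w' (k + 1) ≤ w' k) → ∀ h' : Finset (Sym2 V) → ℝ,
      (∀ ⦃X Y : Finset (Sym2 V)⦄, X ⊆ Y → Y ⊆ N ∩ F → h' X ≤ h' Y) →
      ∑ γ ∈ (N ∩ F).powerset, (w' (clusterCount (↑(insert s(s, t) (γ ∪ insert e (A ∩ F))) : BondConfig V) ∅ +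
          clusterCount (↑(insert s(s, t) ((N ∩ F) \ γ ∪ C ∩ F)) : BondConfig V) ∅) -
        w' (clusterCount (↑(insert s(s, t) ((N ∩ F) \ γ ∪ insert e (A ∩ F))) : BondConfig V) ∅ +
          clusterCount (↑(insert s(s, t) (γ ∪ C ∩ F)) : BondConfig V) ∅)) * h' γ ≤ 0 := by
  intro w' hw' h' hm'
  have hins : ∀ X Y : Finset (Sym2 V), X ∪ insert s(s, t) Y = insert s(s, t) (X ∪ Y) := fun X Y => Finset.union_insert _ _ _
  have key := andGenW_rootless_nonpos_of_isTTSP hF Finset.inter_subset_right (A := insert s(s, t) (insert e (A ∩ F)))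
    (C := insert s(s, t) (C ∩ F))
    (Finset.insert_subset_insert _ (Finset.insert_subset he Finset.inter_subset_right))
    (Finset.insert_subset_insert _ ((orAttT_side hCA hNA).1.trans (Finset.subset_insert _ _)))
    (Finset.disjoint_insert_right.2 ⟨fun hh => hst (Finset.mem_of_mem_inter_right hh), Finset.disjoint_insert_right.2
      ⟨fun hh => heN (Finset.mem_of_mem_inter_left hh), (orAttT_side hCA hNA).2⟩⟩) hw' hm'
  simp_rw [hins] at key
  exact key

/-- Oracle (parallel strands): the `st`-CONTRACTED drift `(st, A ∩ F | st, C ∩ F)` of the free set `(N ∩ F) ∪ {e}`.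
[cite: Grimmett2006, §3.8 Thm. (3.90) (pp. 61–62)] -/
theorem orAttT_inL {s t : V} {e : Sym2 V} (hst : s(s, t) ∉ F) (hF : IsTTSP F s t) (he : e ∈ F) (heA : e ∉ A) (hCA : C ⊆ A)
    (hNA : Disjoint N A) :
    ∀ w' : ℕ → ℝ, (∀ k : ℕ, w' (k + 1) ≤ w' k) → ∀ h' : Finset (Sym2 V) → ℝ,
      (∀ ⦃X Y : Finset (Sym2 V)⦄, X ⊆ Y → Y ⊆ insert e (N ∩ F) → h' X ≤ h' Y) →
      ∑ γ ∈ (insert e (N ∩ F)).powerset, (w' (clusterCount (↑(insert s(s, t) (γ ∪ A ∩ F)) : BondConfig V) ∅ +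
          clusterCount (↑(insert s(s, t) (insert e (N ∩ F) \ γ ∪ C ∩ F)) : BondConfig V) ∅) -
        w' (clusterCount (↑(insert s(s, t) (insert e (N ∩ F) \ γ ∪ A ∩ F)) : BondConfig V) ∅ +
          clusterCount (↑(insert s(s, t) (γ ∪ C ∩ F)) : BondConfig V) ∅)) * h' γ ≤ 0 := by
  intro w' hw' h' hm'
  have hins : ∀ X Y : Finset (Sym2 V), X ∪ insert s(s, t) Y = insert s(s, t) (X ∪ Y) := fun X Y => Finset.union_insert _ _ _
  have heS : e ≠ s(s, t) := fun hh => hst (hh ▸ he)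
  have key := andGenW_rootless_nonpos_of_isTTSP hF (N := insert e (N ∩ F)) (Finset.insert_subset he Finset.inter_subset_right)
    (A := insert s(s, t) (A ∩ F)) (C := insert s(s, t) (C ∩ F))
    (Finset.insert_subset_insert _ Finset.inter_subset_right) (Finset.insert_subset_insert _ (orAttT_side hCA hNA).1)
    (Finset.disjoint_insert_left.2 ⟨by
        rw [Finset.mem_insert, not_or]; exact ⟨heS, fun hh => heA (Finset.mem_of_mem_inter_left hh)⟩,
      Finset.disjoint_insert_right.2 ⟨fun hh => hst (Finset.mem_of_mem_inter_right hh), (orAttT_side hCA hNA).2⟩⟩) hw' hm'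
  simp_rw [hins] at key
  exact key

/-- Oracle (parallel strands): the `st`-CONTRACTED drift `(st, A ∩ F | st, C ∩ F)` of the free set `N ∩ F`.
[cite: Grimmett2006, §3.8 Thm. (3.90) (pp. 61–62)] -/
theorem orAttT_inL₀ {s t : V} (hst : s(s, t) ∉ F) (hF : IsTTSP F s t) (hCA : C ⊆ A) (hNA : Disjoint N A) :
    ∀ w' : ℕ → ℝ, (∀ k : ℕ, w' (k + 1) ≤ w' k) → ∀ h' : Finset (Sym2 V) → ℝ,
      (∀ ⦃X Y : Finset (Sym2 V)⦄, X ⊆ Y → Y ⊆ N ∩ F → h' X ≤ h' Y) →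
      ∑ γ ∈ (N ∩ F).powerset, (w' (clusterCount (↑(insert s(s, t) (γ ∪ A ∩ F)) : BondConfig V) ∅ +
          clusterCount (↑(insert s(s, t) ((N ∩ F) \ γ ∪ C ∩ F)) : BondConfig V) ∅) -
        w' (clusterCount (↑(insert s(s, t) ((N ∩ F) \ γ ∪ A ∩ F)) : BondConfig V) ∅ +
          clusterCount (↑(insert s(s, t) (γ ∪ C ∩ F)) : BondConfig V) ∅)) * h' γ ≤ 0 := by
  intro w' hw' h' hm'
  have hins : ∀ X Y : Finset (Sym2 V), X ∪ insert s(s, t) Y = insert s(s, t) (X ∪ Y) := fun X Y => Finset.union_insert _ _ _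
  have key := andGenW_rootless_nonpos_of_isTTSP hF Finset.inter_subset_right (A := insert s(s, t) (A ∩ F))
    (C := insert s(s, t) (C ∩ F)) (Finset.insert_subset_insert _ Finset.inter_subset_right)
    (Finset.insert_subset_insert _ (orAttT_side hCA hNA).1)
    (Finset.disjoint_insert_right.2 ⟨fun hh => hst (Finset.mem_of_mem_inter_right hh), (orAttT_side hCA hNA).2⟩) hw' hm'
  simp_rw [hins] at key
  exact key

end OrAttTInputs

end FK

end Summit.CriticalPhenomena.PercolationContinuityZ3.Theorems

end
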